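import Summits.QuantumFields.YangMills.Theorems.UnitScaleTiltProp7SectET3CurvedPropagatorsT3
import HarnessLib

/-!
# Route `UnitScaleTilt`, crux K1 «MinimiserStabilityRegPr» (stmt-QuantumFields-19200), EX rows `norm_H₁` ∕ `norm_Hπ` — **(N1-H) THE (115) → sup DOOR FOR THE READER `H1f`** (twin of N1
# `Prop7FrakGfRNormOfSupLetters` for `frakGfR`).

Cell `ym3-torus` (HUMAN RULING D-0037; rung R3 = SU(2) YM₃ on T³ — NOT d = 4, NOT infinite volume, NOT a mass gap, NOT Clay).  Free prover hand `ym-line-cst-p1` (gen 36); ★p1 g27 CHAIR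
WORD №24 «THE NORM_G ROAD … the Π-slot twin road (`norm_Hπ`, `h133`, `h88`, `h137kπ`) shares N3–N7».  THEOREMS ONLY (0 `def`, 0 `sorry`, default heartbeats);
`--supports stmt-QuantumFields-19200 --as helper`; count-neutral.

THE ROWS.  The EX display ✓`Prop7StubEXOfChartPiecesTwS47.stubEX_of_chartPiecesTwS47` asks, as its binders `norm_H₁` (slot `DeltaOnePJ … (a L i)`) and `norm_Hπ` (slot `DeltaPiSlotP … (a L i)`),
under `RegPr` + cap + `Lift`: `∀ b, ‖H1f … slot U₀ b‖ ≤ B₀ L * ‖b‖` — [Balaban1985Variational] (103) p. 293 *«|H₁B|, |∇H₁B| ≤ O(1)|B|»* read in the norm (115)∕(117) for print's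
`H₁ = G₁Q*(QG₁Q*)⁻¹` (3.129)∕`H = GQ*(QGQ*)⁻¹` (3.126) of [Balaban1985BackgroundPropagators], from the block fields `PBond (F.P n) 0 → M₂(ℂ)` (sup norm) into `Space115 L η (K−n) (K−n) ∇_{U₀}`
(`H1f`, ✓`Prop7SectET3CurvedPropagators`; `∇_{U₀} = nabla115 η (bgOfCfg F K U₀)`, `η = L^{−(K−n)}`).

WHAT THIS FILE SAYS (the door; no analysis).  At a member every weight of (115) is one (✓`Prop7SectET3Transport.norm_negSize_const_eq`), so
* §1 `equiv_H1f_eq_cfgEquiv`: the configuration underlying `H1f … U₀ b` is `X_b := toL2⁻¹(H(toL2B b))` re-indexed along ✓`cfgEquiv` (`H = HT … U₀`, the Hilbert-level total letter),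
  by ✓`H1f_apply` ∕ ✓`toL2_symm_apply` (`cfgEquiv F K _ X = fun q ↦ X ((bondEquiv F K)⁻¹ q)` by `rfl`, ✓`Prop7FrakGfRNormOfSupLetters.cfgEquiv_eq_lambda`);
* §2 ★ `norm_H1f_apply_eq`: **`‖H1f … U₀ b‖ = max ‖X_b‖_∞ ‖∇_{U₀}(X_b ∘ bondEquiv⁻¹)‖_∞`**;
* §3 ★★ THE DOOR `norm_H1f_apply_le_of_route_letters`: the bondwise VALUE letter `‖X_b b_d‖ ≤ M_V‖b‖_∞` (the currency of the `h133`-class kernel rows after a row sum, `flat115 = JetSup.equiv`)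
  and the (115)-GRADIENT letter `‖∇_{U₀}(X_b ∘ bondEquiv⁻¹)‖_∞ ≤ M_∇‖b‖_∞` (N5's shape, ✓∕⧗`Prop7OneFormGradientSupNabla`) give `‖H1f … U₀ b‖ ≤ max M_V M_∇ · ‖b‖`;
  ★★ `forall_norm_H1f_le_iff_route`: **`norm_H₁`∕`norm_Hπ`'s inequality with constant `B` IS EXACTLY the pair of letters with the same `B`**; `opNorm_H1f_le_of_route_letters`.
SLOT-GENERIC (`Δx` arbitrary: `DeltaOnePJ` gives `norm_H₁`, `DeltaPiSlotP` gives `norm_Hπ`, verbatim).  HYP-SAT (★★OWNER RULING №42): nothing displayed (identities∕iffs at the member; no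
`RegPr`∕`Lift`∕cap consumed); non-vacuous; no `Prop` placeholder.
HONEST SCOPE.  Bookkeeping only.  Nothing of the letters (the K-storey N7, `h133`, (3.126)'s words), of `norm_H₁`∕`norm_Hπ`, the eight EX rows, `hThm2S`, EX, the crux or the rung is proved
here; rung R3 = SU(2) YM₃ on T³ — NOT d = 4, NOT infinite volume, NOT a mass gap, NOT Clay; the Yang–Mills mass gap is NOT proved.

References: T. Bałaban, CMP **102** (1985) 277–309 [Balaban1985Variational] ((103) p.293, (115)–(117) pp.294–295); CMP **99** (1985) 389–434 [Balaban1985BackgroundPropagators]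
((3.3) p.391, (3.11) p.392, (3.126) p.420, (3.129) p.421, Thm 3.13 p.426).
-/

set_option autoImplicit false

noncomputable section

open scoped BigOperators Matrix.Norms.L2Operator InnerProductSpace

namespace Summit.QuantumFields.YangMills.Theorems.Prop7H1fNormOfSupLetters

open Literature.MathematicalPhysics.QuantumFieldTheory.Balaban1983to89
open Literature.MathematicalPhysics.QuantumFieldTheory.Balaban1983to89.T3ContinuumYM3Torus
open B9SectCLatticeCarrier (Bond)
open B9Eq311L2Pairing (WL2)
open B11Eq115Space (NegSize Space115 JetSup NegSup levWeight)
open B11Eq111FrakG (nabla115)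
open B11Eq103H1Complex (BondL2K)
open Summit.QuantumFields.YangMills.Theorems.Prop7SectET3Transport (periodsT3 bondEquiv cfgEquiv bgOfCfg cfgEquiv_apply norm_cfgEquiv norm_negSize_const_eq)
open Summit.QuantumFields.YangMills.Theorems.Prop7SectET3HilbertLetters (W₂ frobEquiv toL2 toL2B toL2_symm_apply)
open Summit.QuantumFields.YangMills.Theorems.Prop7SectET3CurvedPropagators (HT H1f H1f_apply)

variable (F : T3Family) (n K : ℕ) (h : n ≤ K) (c₀ cB a : ℝ) [Fact (0 < c₀)] [Fact (0 < cB)]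
  (Δx : GaugeField (F.P K) 0 (Matrix.specialUnitaryGroup (Fin 2) ℂ) → (BondL2K ℂ 3 (periodsT3 F K) c₀ W₂ →ₗ[ℂ] BondL2K ℂ 3 (periodsT3 F K) c₀ W₂))
  [Fact (0 < (F.L : ℝ))] [Fact (0 < ((F.L : ℝ)⁻¹) ^ (K - n))]
  (U₀ : GaugeField (F.P K) 0 (Matrix.specialUnitaryGroup (Fin 2) ℂ))

/-! ## §1 The configuration underlying `H1f … b` in the route's currency -/

/-- **THE CONFIGURATION UNDERLYING `H1f … U₀ b` IS `toL2⁻¹(H(toL2B b))` RE-INDEXED** along ✓`cfgEquiv` (`H = HT … U₀`; ✓`H1f_apply`, ✓`toL2_symm_apply`).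
[cite: Balaban1985Variational, (103) p.293; Balaban1985BackgroundPropagators, (3.126) p.420] -/
theorem equiv_H1f_eq_cfgEquiv (b : PBond (F.P n) 0 → Matrix (Fin 2) (Fin 2) ℂ) :
    JetSup.equiv _ _ _ (H1f F n K h c₀ cB a Δx U₀ b) = cfgEquiv F K _ ((toL2 F K c₀).symm (HT F n K h c₀ cB a Δx U₀ (toL2B F n cB b))) := by
  funext p
  rw [H1f_apply, cfgEquiv_apply, toL2_symm_apply, Equiv.apply_symm_apply]

/-! ## §2 The (117) norm of `H1f … b` as a max of two sups -/

/-- ★ **`‖H1f … U₀ b‖ = max ‖X_b‖_∞ ‖∇_{U₀}(X_b ∘ bondEquiv⁻¹)‖_∞`**, `X_b := toL2⁻¹(H(toL2B b))` (all (115) weights are one at the member; the sup norm is re-indexing invariant, ✓`norm_cfgEquiv`).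
[cite: Balaban1985Variational, (103) p.293, (115) p.294, (117) p.295] -/
theorem norm_H1f_apply_eq (b : PBond (F.P n) 0 → Matrix (Fin 2) (Fin 2) ℂ) :
    ‖H1f F n K h c₀ cB a Δx U₀ b‖ =
      max ‖(toL2 F K c₀).symm (HT F n K h c₀ cB a Δx U₀ (toL2B F n cB b))‖
        ‖nabla115 (((F.L : ℝ)⁻¹) ^ (K - n)) (bgOfCfg F K U₀)
          (fun q : Bond 3 (periodsT3 F K) => (toL2 F K c₀).symm (HT F n K h c₀ cB a Δx U₀ (toL2B F n cB b)) ((bondEquiv F K).symm q))‖ := by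
  rw [B11Eq115Space.JetSup.norm_def (H1f F n K h c₀ cB a Δx U₀ b), norm_negSize_const_eq (K - n) 1 (JetSup.fst _), norm_negSize_const_eq (K - n) 2 (JetSup.snd _),
    JetSup.equiv_fst, JetSup.equiv_snd, equiv_H1f_eq_cfgEquiv, norm_cfgEquiv]
  rfl

/-! ## §3 The door: `norm_H₁`∕`norm_Hπ`'s inequality from — and equivalent to — the two route letters -/

/-- ★★ **THE DOOR**: the bondwise VALUE letter `‖X_b b_d‖ ≤ M_V‖b‖_∞` and the (115)-GRADIENT letter `‖∇_{U₀}(X_b ∘ bondEquiv⁻¹)‖_∞ ≤ M_∇‖b‖_∞` (`X_b := toL2⁻¹(H(toL2B b))`) give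
`‖H1f … U₀ b‖ ≤ max M_V M_∇ · ‖b‖` — (103) in the norm (117) at a member. ANY slot `Δx` (`DeltaOnePJ`: `norm_H₁`; `DeltaPiSlotP`: `norm_Hπ`).
[cite: Balaban1985Variational, (103) p.293, (117) p.295; Balaban1985BackgroundPropagators, Thm 3.13 p.426] -/
theorem norm_H1f_apply_le_of_route_letters {MV MG : ℝ} (hMV : 0 ≤ MV)
    (hV : ∀ (b : PBond (F.P n) 0 → Matrix (Fin 2) (Fin 2) ℂ) (bd : PBond (F.P K) 0), ‖(toL2 F K c₀).symm (HT F n K h c₀ cB a Δx U₀ (toL2B F n cB b)) bd‖ ≤ MV * ‖b‖)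
    (hG : ∀ b : PBond (F.P n) 0 → Matrix (Fin 2) (Fin 2) ℂ,
      ‖nabla115 (((F.L : ℝ)⁻¹) ^ (K - n)) (bgOfCfg F K U₀)
          (fun q : Bond 3 (periodsT3 F K) => (toL2 F K c₀).symm (HT F n K h c₀ cB a Δx U₀ (toL2B F n cB b)) ((bondEquiv F K).symm q))‖ ≤ MG * ‖b‖)
    (b : PBond (F.P n) 0 → Matrix (Fin 2) (Fin 2) ℂ) :
    ‖H1f F n K h c₀ cB a Δx U₀ b‖ ≤ max MV MG * ‖b‖ := by
  rw [norm_H1f_apply_eq]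
  exact max_le (((pi_norm_le_iff_of_nonneg (mul_nonneg hMV (norm_nonneg _))).2 (hV b)).trans (mul_le_mul_of_nonneg_right (le_max_left _ _) (norm_nonneg _)))
    ((hG b).trans (mul_le_mul_of_nonneg_right (le_max_right _ _) (norm_nonneg _)))

/-- ★★ **`norm_H₁`∕`norm_Hπ` IS EXACTLY THE TWO ROUTE LETTERS**: `(∀ b, ‖H1f … U₀ b‖ ≤ B‖b‖) ↔ (∀ b b_d, ‖X_b b_d‖ ≤ B‖b‖_∞) ∧ ∀ b, ‖∇_{U₀}(X_b ∘ bondEquiv⁻¹)‖_∞ ≤ B‖b‖_∞` (`0 ≤ B`).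
[cite: Balaban1985Variational, (103) p.293, (115) p.294, (117) p.295] -/
theorem forall_norm_H1f_le_iff_route {B : ℝ} (hB : 0 ≤ B) :
    (∀ b : PBond (F.P n) 0 → Matrix (Fin 2) (Fin 2) ℂ, ‖H1f F n K h c₀ cB a Δx U₀ b‖ ≤ B * ‖b‖) ↔
      (∀ (b : PBond (F.P n) 0 → Matrix (Fin 2) (Fin 2) ℂ) (bd : PBond (F.P K) 0), ‖(toL2 F K c₀).symm (HT F n K h c₀ cB a Δx U₀ (toL2B F n cB b)) bd‖ ≤ B * ‖b‖) ∧
        ∀ b : PBond (F.P n) 0 → Matrix (Fin 2) (Fin 2) ℂ,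
          ‖nabla115 (((F.L : ℝ)⁻¹) ^ (K - n)) (bgOfCfg F K U₀)
              (fun q : Bond 3 (periodsT3 F K) => (toL2 F K c₀).symm (HT F n K h c₀ cB a Δx U₀ (toL2B F n cB b)) ((bondEquiv F K).symm q))‖ ≤ B * ‖b‖ := by
  refine ⟨fun hf => ⟨fun b bd => ?_, fun b => ?_⟩, fun hA b => ?_⟩
  · have h1 := hf b
    rw [norm_H1f_apply_eq, max_le_iff] at h1
    exact (norm_le_pi_norm _ bd).trans h1.1
  · have h1 := hf b
    rw [norm_H1f_apply_eq, max_le_iff] at h1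
    exact h1.2
  · have h1 := norm_H1f_apply_le_of_route_letters F n K h c₀ cB a Δx U₀ hB hA.1 hA.2 b
    rwa [max_self] at h1

/-- The operator-norm form of the door: `‖H1f … U₀‖ ≤ max M_V M_∇` (for `0 ≤ M_V`). [cite: Balaban1985Variational, (103) p.293, (117) p.295] -/
theorem opNorm_H1f_le_of_route_letters {MV MG : ℝ} (hMV : 0 ≤ MV)
    (hV : ∀ (b : PBond (F.P n) 0 → Matrix (Fin 2) (Fin 2) ℂ) (bd : PBond (F.P K) 0), ‖(toL2 F K c₀).symm (HT F n K h c₀ cB a Δx U₀ (toL2B F n cB b)) bd‖ ≤ MV * ‖b‖)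
    (hG : ∀ b : PBond (F.P n) 0 → Matrix (Fin 2) (Fin 2) ℂ,
      ‖nabla115 (((F.L : ℝ)⁻¹) ^ (K - n)) (bgOfCfg F K U₀)
          (fun q : Bond 3 (periodsT3 F K) => (toL2 F K c₀).symm (HT F n K h c₀ cB a Δx U₀ (toL2B F n cB b)) ((bondEquiv F K).symm q))‖ ≤ MG * ‖b‖) :
    ‖H1f F n K h c₀ cB a Δx U₀‖ ≤ max MV MG :=
  ContinuousLinearMap.opNorm_le_bound _ (le_max_of_le_left hMV) (norm_H1f_apply_le_of_route_letters F n K h c₀ cB a Δx U₀ hMV hV hG)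

end Summit.QuantumFields.YangMills.Theorems.Prop7H1fNormOfSupLetters

end
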